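import Literature.Probability.LatticeModels.DelaunayGraph
import HarnessLib

/-!
# Nearest-neighbour edges of the jittered square lattice are Delaunay pairs — stub `stub_jsdEdges`
# of line `SketchIdeator5R2` for crux `SquareFromVoronoiHub` (stmt-CriticalPhenomena-6434, route
# CardyFlipRusso, sub-problem CardyFormulaZ2)

For a jitter field `ξ : ℤ × ℤ → ℂ` with `‖ξ v‖ ≤ a`, `0 ≤ a < (1 - 1/√2)/2`, every horizontal or
vertical edge `{v, w}` of `ℤ²` is a Delaunay pair (closed empty circumscribed ball rule,
`Literature.Probability.LatticeModels.IsDelaunayPair`) of the jittered sites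
`S = {u.1 + u.2 I + ξ u | u ∈ ℤ²}`.  Witness: the ball centred at the midpoint `c` of the jittered
edge, radius `‖p v - p w‖ / 2 ≤ 1/2 + a`; a third site `p u` is at distance `≥ ‖z u - m‖ - 2a ≥ 1 - 2a`
from `c` (`m` the lattice midpoint of the edge, `‖z u - m‖² ≥ 5/4 ≥ 1` for `u ∉ {v, w}`), and
`1/2 + a ≤ 1 - 2a` because `a < (1 - 1/√2)/2 < 1/6`.  Elementary planar geometry; no named facts.
-/

noncomputable section

open Literature.Probability.LatticeModels (IsDelaunayPair)

namespace Summit.CriticalPhenomena.CardyFormulaZ2.Cruxes.SquareFromVoronoiHub.ProductLeg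

namespace stub_jsdEdgesAux

/-- **Midpoint ball comparison.**  If `P, V, W` are within `a` of `ZU, ZV, ZW`, `‖ZV - ZW‖ ≤ 1`,
the unperturbed point `ZU` is at distance `≥ 1` from the unperturbed midpoint `(ZV + ZW)/2`, and
`6a ≤ 1`, then `P` is no closer to the perturbed midpoint `(V + W)/2` than `V` is. [folklore] -/
theorem dist_mid_le {a : ℝ} {P V W ZU ZV ZW : ℂ} (ha : 6 * a ≤ 1)
    (hP : ‖P - ZU‖ ≤ a) (hV : ‖V - ZV‖ ≤ a) (hW : ‖W - ZW‖ ≤ a)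
    (hVW : ‖ZV - ZW‖ ≤ 1) (hU : 1 ≤ ‖ZU - (ZV + ZW) / 2‖) :
    dist V ((V + W) / 2) ≤ dist P ((V + W) / 2) := by
  rw [dist_eq_norm, dist_eq_norm]
  have e1 : V - (V + W) / 2 = ((ZV - ZW) + ((V - ZV) - (W - ZW))) / 2 := by ring
  have e2 : P - (V + W) / 2 =
      (ZU - (ZV + ZW) / 2) + ((P - ZU) - ((V - ZV) + (W - ZW)) / 2) := by ring
  rw [e1, e2]
  have h1 : ‖((ZV - ZW) + ((V - ZV) - (W - ZW))) / 2‖ ≤ (1 + (a + a)) / 2 := by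
    rw [norm_div, Complex.norm_two]
    gcongr
    exact (norm_add_le _ _).trans (add_le_add hVW ((norm_sub_le _ _).trans (add_le_add hV hW)))
  have h2 : ‖(P - ZU) - ((V - ZV) + (W - ZW)) / 2‖ ≤ a + (a + a) / 2 := by
    refine (norm_sub_le _ _).trans (add_le_add hP ?_)
    rw [norm_div, Complex.norm_two]
    gcongr
    exact (norm_add_le _ _).trans (add_le_add hV hW)
  have h3 := norm_le_add_norm_add (ZU - (ZV + ZW) / 2) ((P - ZU) - ((V - ZV) + (W - ZW)) / 2)
  linarith

/-- **Lattice separation.**  For integers `s, t` with `(s, t) ∉ {(0, 0), (1, 0)}`: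
`1 ≤ (s - 1/2)² + t²` (indeed `≥ 5/4`). [folklore] -/
theorem one_le_sq_add_sq (s t : ℤ) (h0 : s ≠ 0 ∨ t ≠ 0) (h1 : s ≠ 1 ∨ t ≠ 0) :
    1 ≤ ((s : ℝ) - 1 / 2) ^ 2 + (t : ℝ) ^ 2 := by
  rcases eq_or_ne t 0 with ht | ht
  · subst ht
    have hs : s ≤ -1 ∨ 2 ≤ s := by omega
    rcases hs with hs | hs
    · have hs' : (s : ℝ) ≤ -1 := by exact_mod_cast hs
      push_cast
      nlinarith
    · have hs' : (2 : ℝ) ≤ s := by exact_mod_cast hs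
      push_cast
      nlinarith
  · have ht1 : 1 ≤ |t| := Int.one_le_abs ht
    have ht1' : (1 : ℝ) ≤ |(t : ℝ)| := by
      rw [← Int.cast_abs]
      exact_mod_cast ht1
    have ht2 : (1 : ℝ) ≤ (t : ℝ) ^ 2 := by
      rw [← sq_abs]
      nlinarith
    nlinarith [sq_nonneg ((s : ℝ) - 1 / 2)]

/-- The jitter bound of the line, `a < (1 - 1/√2)/2`, implies `6a ≤ 1` (since `√2 < 3/2`).
[folklore] -/
theorem six_mul_le_one {a : ℝ} (hlt : a < (1 - 1 / Real.sqrt 2) / 2) : 6 * a ≤ 1 := by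
  have hs : Real.sqrt 2 < 3 / 2 := by
    rw [Real.sqrt_lt' (by norm_num)]
    norm_num
  have hs0 : 0 < Real.sqrt 2 := Real.sqrt_pos.2 (by norm_num)
  have h23 : 2 / 3 < 1 / Real.sqrt 2 := by
    rw [div_lt_div_iff₀ (by norm_num) hs0]
    linarith
  linarith

/-- **Workhorse.**  If the lattice edge `{v, w}` has length `≤ 1`, every other lattice point is at
distance `≥ 1` from its midpoint, the jitters are bounded by `a` and `6a ≤ 1`, then the jittered
edge is a Delaunay pair of the jittered lattice: the closed ball on the jittered edge as a diameter
contains no jittered site in its interior. [folklore] -/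
theorem isDelaunayPair_of_far {a : ℝ} (ξ : ℤ × ℤ → ℂ) (ha : 6 * a ≤ 1) (hξ : ∀ v, ‖ξ v‖ ≤ a)
    (v w : ℤ × ℤ)
    (hvw : ‖((v.1 : ℂ) + (v.2 : ℂ) * Complex.I) - ((w.1 : ℂ) + (w.2 : ℂ) * Complex.I)‖ ≤ 1)
    (hfar : ∀ u : ℤ × ℤ, u ≠ v → u ≠ w →
      1 ≤ ‖((u.1 : ℂ) + (u.2 : ℂ) * Complex.I) -
        (((v.1 : ℂ) + (v.2 : ℂ) * Complex.I) + ((w.1 : ℂ) + (w.2 : ℂ) * Complex.I)) / 2‖) :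
    IsDelaunayPair (Set.range fun u : ℤ × ℤ => ((u.1 : ℂ) + (u.2 : ℂ) * Complex.I) + ξ u)
      (((v.1 : ℂ) + (v.2 : ℂ) * Complex.I) + ξ v) (((w.1 : ℂ) + (w.2 : ℂ) * Complex.I) + ξ w) := by
  refine ⟨((((v.1 : ℂ) + (v.2 : ℂ) * Complex.I) + ξ v) +
      (((w.1 : ℂ) + (w.2 : ℂ) * Complex.I) + ξ w)) / 2,
    dist (((v.1 : ℂ) + (v.2 : ℂ) * Complex.I) + ξ v)
      (((((v.1 : ℂ) + (v.2 : ℂ) * Complex.I) + ξ v) +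
        (((w.1 : ℂ) + (w.2 : ℂ) * Complex.I) + ξ w)) / 2),
    rfl, ?_, ?_⟩
  · -- both endpoints of a segment are equidistant from its midpoint
    rw [dist_eq_norm, dist_eq_norm, ← norm_neg]
    congr 1
    ring
  · rintro _ ⟨u, rfl⟩
    by_cases hu : u = v ∨ u = w
    · rcases hu with rfl | rfl
      · exact le_rfl
      · rw [dist_eq_norm, dist_eq_norm, ← norm_neg]
        apply le_of_eq
        congr 1
        ring
    · push Not at hu
      refine dist_mid_le (ZU := (u.1 : ℂ) + (u.2 : ℂ) * Complex.I)
        (ZV := (v.1 : ℂ) + (v.2 : ℂ) * Complex.I) (ZW := (w.1 : ℂ) + (w.2 : ℂ) * Complex.I)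
        ha ?_ ?_ ?_ hvw (hfar u hu.1 hu.2)
      · simpa using hξ u
      · simpa using hξ v
      · simpa using hξ w

end stub_jsdEdgesAux

open stub_jsdEdgesAux in
/-- **stub_jsdEdges** (endpoint geometry (i) of line `SketchIdeator5R2`): for jitter amplitude
`0 ≤ a < (1 - 1/√2)/2` and jitters `‖ξ v‖ ≤ a`, every nearest-neighbour edge of `ℤ²` — horizontal
`w = v + (1, 0)` or vertical `w = v + (0, 1)` — is a Delaunay pair of the jittered point set
`{u.1 + u.2 I + ξ u}`: the closed ball on the jittered edge as a diameter (radius `≤ 1/2 + a`) has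
every other jittered site at distance `≥ 1 - 2a ≥ 1/2 + a` from its centre. [folklore] -/
theorem stub_jsdEdges :
    ∀ (a : ℝ) (ξ : ℤ × ℤ → ℂ), 0 ≤ a → a < (1 - 1 / Real.sqrt 2) / 2 → (∀ v, ‖ξ v‖ ≤ a) →
      ∀ v w : ℤ × ℤ, (w = (v.1 + 1, v.2) ∨ w = (v.1, v.2 + 1)) →
        IsDelaunayPair (Set.range fun u : ℤ × ℤ => ((u.1 : ℂ) + (u.2 : ℂ) * Complex.I) + ξ u)
          (((v.1 : ℂ) + (v.2 : ℂ) * Complex.I) + ξ v) (((w.1 : ℂ) + (w.2 : ℂ) * Complex.I) + ξ w) := by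
  intro a ξ _ hlt hξ v w hw
  refine isDelaunayPair_of_far ξ (six_mul_le_one hlt) hξ v w ?_ ?_
  · -- the lattice edge has length `1`
    rcases hw with rfl | rfl
    · have e : ((v.1 : ℂ) + (v.2 : ℂ) * Complex.I) -
          ((((v.1 + 1, v.2) : ℤ × ℤ).1 : ℂ) + (((v.1 + 1, v.2) : ℤ × ℤ).2 : ℂ) * Complex.I) =
            -1 := by
        push_cast
        ring
      rw [e, norm_neg, norm_one]
    · have e : ((v.1 : ℂ) + (v.2 : ℂ) * Complex.I) -
          ((((v.1, v.2 + 1) : ℤ × ℤ).1 : ℂ) + (((v.1, v.2 + 1) : ℤ × ℤ).2 : ℂ) * Complex.I) =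
            -Complex.I := by
        push_cast
        ring
      rw [e, norm_neg, Complex.norm_I]
  · -- every other lattice point is at distance `≥ 1` from the lattice midpoint of the edge
    intro u hu1 hu2
    rcases hw with rfl | rfl
    · have e : ((u.1 : ℂ) + (u.2 : ℂ) * Complex.I) -
          (((v.1 : ℂ) + (v.2 : ℂ) * Complex.I) +
            ((((v.1 + 1, v.2) : ℤ × ℤ).1 : ℂ) + (((v.1 + 1, v.2) : ℤ × ℤ).2 : ℂ) * Complex.I)) / 2 =
          ((((u.1 - v.1 : ℤ) : ℝ) - 1 / 2 : ℝ) : ℂ) + (((u.2 - v.2 : ℤ) : ℝ) : ℂ) * Complex.I := by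
        push_cast
        ring
      rw [e, Complex.norm_add_mul_I]
      refine Real.le_sqrt_of_sq_le ?_
      rw [one_pow]
      refine one_le_sq_add_sq (u.1 - v.1) (u.2 - v.2) ?_ ?_
      · by_contra h
        push Not at h
        exact hu1 (Prod.ext (by omega) (by omega))
      · by_contra h
        push Not at h
        exact hu2 (Prod.ext (show u.1 = v.1 + 1 by omega) (show u.2 = v.2 by omega))
    · have e : ((u.1 : ℂ) + (u.2 : ℂ) * Complex.I) -
          (((v.1 : ℂ) + (v.2 : ℂ) * Complex.I) +
            ((((v.1, v.2 + 1) : ℤ × ℤ).1 : ℂ) + (((v.1, v.2 + 1) : ℤ × ℤ).2 : ℂ) * Complex.I)) / 2 =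
          ((((u.1 - v.1 : ℤ) : ℝ) : ℝ) : ℂ) +
            ((((u.2 - v.2 : ℤ) : ℝ) - 1 / 2 : ℝ) : ℂ) * Complex.I := by
        push_cast
        ring
      rw [e, Complex.norm_add_mul_I]
      refine Real.le_sqrt_of_sq_le ?_
      rw [one_pow, add_comm]
      refine one_le_sq_add_sq (u.2 - v.2) (u.1 - v.1) ?_ ?_
      · by_contra h
        push Not at h
        exact hu1 (Prod.ext (by omega) (by omega))
      · by_contra h
        push Not at h
        exact hu2 (Prod.ext (show u.1 = v.1 by omega) (show u.2 = v.2 + 1 by omega))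

end Summit.CriticalPhenomena.CardyFormulaZ2.Cruxes.SquareFromVoronoiHub.ProductLeg

end
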